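import Summits.QuantumFields.YangMills.Theorems.VirialFluxGapRingStabilizerRigidity
import Summits.QuantumFields.YangMills.Theorems.VirialFluxGapTwistEaterConjugacy
import HarnessLib

/-!
# Quantitative ORBIT SEPARATION of the twist-eater classes (tube disjointness ∕ localisation input of the direct Laplace road)
# (layer (B), chart-free input, of the DIRECT Laplace road to ⟨stmt-QuantumFields-24204⟩ `VirialFluxGap.SharpTwistedLaplace`)

Helper module (free-hands work of width seat ym-line-sfw-p2-w3 g56, cell ym-idea-1; `--supports 24204`).  The zero set of the twisted ring
deficit `F_z` (`z ≠ 0`) is, in comb gauge, the set of rings `(combFlat w; λ·c)` with commuting wraps `w` and the twist-eater relations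
`c w_k c⁻¹ = centreElem(z_k) w_k` (✓`exists_combGauge_of_ringDeficit_eq_zero`), i.e. finitely many gauge orbits labelled by the GAUGE
INVARIANTS `w_k ∈ {±1}` (untwisted `k`) and `w_{k₁} w_{k₂} ∈ {±1}` (twisted `k₁ ≠ k₂`).  The bookkeeping over several critical orbits
(✓`QuantitativeLaplace.laplaceMethod_quantitative_sum_of_tubes`) needs the tubes around DIFFERENT orbits to be disjoint, and the coercivity
along a transversal slice at one orbit needs the other orbits to be far: both follow from a QUANTITATIVE separation of the orbits in the
chordal ring distance, proved here CHART-FREE with a bound polynomial in `L`: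

* §1 `twistEater_sign_invariants` — the invariants are signs: untwisted `w_k ∈ {1, negOne}`, twisted products `w_{k₁} w_{k₂} ∈ {1, negOne}`
  (✓`QuantitativeLaplace.twistEater_structure`, ✓`pure_unit_mul_self`, transported along `su2Quat`); `two_le_fd_of_sign_ne` — two DIFFERENT signs are at Frobenius
  distance `≥ 2`;
* §2 ★★ `ringDist_ge_of_invariants_ne` — for two comb-form rings `R = (combFlat w; g)`, `R' = (combFlat w'; g')` (twist-eater wraps, ARBITRARY
  seam fields) whose invariants differ and EVERY gauge field `h`: `ringDist(h·R, R') ≥ 1/(18L)` (inlined chordal distance of the Theses, `h·R`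
  in the form of ✓`…RingGaugeAction`).  Mechanism (the tree-constancy argument of ✓`…RingStabilizerRigidity`): with `T` the common slice
  term, every link of `h·combFlat w` is `2√T`-close to the corresponding link of `combFlat w'`, so `h` is `6(L−1)√T`-constant along the comb
  (✓`fd_sub_base_le_of_treeEdge`) and the wrap edges force `u w_k u⁻¹ ≈ w'_k` (`u = h 0`) within `6L√T`; a differing CENTRAL invariant is
  then `2 ≤ 12L√T`, i.e. `T ≥ 1/(36L²)`, and `ringDist ≥ 2L·T`.

Everything here is PROVED; no definitions, no named facts (namespace `Summit.QuantumFields.YangMills.Theorems.VirialFluxGap.RingDeficit`).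
HONEST FRAMING: lattice∕quaternion algebra; ⟨24204⟩, ⟨24319⟩ and every rung stay OPEN; the Yang–Mills mass gap (Clay) is NOT touched; no
summit is proved by a line.

## References
* M. Lüscher, Nucl. Phys. B219 (1983), §2. [Luscher1983]
* A. González-Arroyo, C. P. Korthals Altes, Nucl. Phys. B311 (1988) §2 (twist-eating configurations and their classes). [GonzalezarroyoAltes1988]
-/

set_option autoImplicit false

noncomputable section

open scoped Quaternion Matrix BigOperators
open Literature.MathematicalPhysics.QuantumFieldTheory hiding SU2
open Literature.MathematicalPhysics.QuantumLattice
open Literature.MathematicalPhysics.QuantumFieldTheory.Balaban1983to89.T4WilsonGaugeFlatDirection (su2Quat_injective)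
open Summit.QuantumFields.YangMills.Theorems.FemtoTransferGap
open Summit.QuantumFields.YangMills.Theorems.FemtoTransferGap.TT
open Summit.QuantumFields.YangMills.Theorems.FemtoTransferGap.TwoLattice
open Summit.QuantumFields.YangMills.Theorems.FemtoTransferGap.TwoLattice.Flat
open Summit.QuantumFields.YangMills.Theorems.FemtoTransferGap.TwoLattice.Cov
open Summit.QuantumFields.YangMills.Theorems.ToronValleyVolume.Lojasiewicz
open Summit.QuantumFields.YangMills.Theorems.TwistEaterVolume.Quadratic
open Summit.QuantumFields.YangMills.Theorems.QuantitativeLaplace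

namespace Summit.QuantumFields.YangMills.Theorems.VirialFluxGap.RingDeficit

/-! ## §1 The invariants of a twist-eater are signs -/

/-- Exact twisted ∕ untwisted commutation in `ℍ` from the twist-eater relation in `SU(2)`. [folklore] -/
theorem su2Quat_twist_rel {c w : SU2} {b : Bool} (h : c * w * c⁻¹ = centreElem b * w) :
    su2Quat c * su2Quat w = (if b then -(su2Quat w * su2Quat c) else su2Quat w * su2Quat c) := by
  have h0 := norm_quat_twist_le_fd c w b
  rw [h, fd_self] at h0
  exact sub_eq_zero.1 (norm_le_zero_iff.1 h0)

/-- `su2Quat a = ±1 ⇒ a ∈ {1, negOne}`. [folklore] -/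
theorem eq_one_or_negOne_of_su2Quat {a : SU2} (h : su2Quat a = 1 ∨ su2Quat a = -1) : a = 1 ∨ a = negOne := by
  rcases h with h | h
  · left; exact su2Quat_injective (by rw [h, su2Quat_one])
  · right; exact su2Quat_injective (by rw [h, su2Quat_negOne])

/-- ★ **The invariants of a twist-eater are signs.**  For commuting wraps `w` and `c` with `c w_k c⁻¹ = centreElem(z_k) w_k`, `z k₀ = true`:
every untwisted `w_k` and every product `w_{k₁} w_{k₂}` of twisted wraps lies in `{1, negOne}`. [cite: GonzalezarroyoAltes1988, §2] -/
theorem twistEater_sign_invariants (z : Fin 3 → Bool) (k₀ : Fin 3) (hk₀ : z k₀ = true) {w : Fin 3 → SU2} {c : SU2}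
    (hww : ∀ i j, w i * w j = w j * w i) (hcw : ∀ k, c * w k * c⁻¹ = centreElem (z k) * w k) :
    (∀ k, z k = false → w k = 1 ∨ w k = negOne) ∧
      (∀ k₁ k₂, z k₁ = true → z k₂ = true → w k₁ * w k₂ = 1 ∨ w k₁ * w k₂ = negOne) := by
  have hcomm : ∀ i j, su2Quat (w i) * su2Quat (w j) = su2Quat (w j) * su2Quat (w i) := fun i j => by
    rw [← su2Quat_mul, ← su2Quat_mul, hww]
  have htw : ∀ k, z k = true → su2Quat c * su2Quat (w k) = -(su2Quat (w k) * su2Quat c) := fun k hk => by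
    have h := su2Quat_twist_rel (hcw k); rw [hk] at h; simpa using h
  have hun : ∀ k, z k = false → su2Quat c * su2Quat (w k) = su2Quat (w k) * su2Quat c := fun k hk => by
    have h := su2Quat_twist_rel (hcw k); rw [hk] at h; simpa using h
  obtain ⟨_, hn0re, _, htws, huns⟩ := twistEater_structure (su2Quat c) (fun k => su2Quat (w k)) z k₀ hk₀ (norm_su2Quat c)
    (fun k => norm_su2Quat (w k)) hcomm htw hun
  have hnn : su2Quat (w k₀) * su2Quat (w k₀) = -1 := pure_unit_mul_self (norm_su2Quat _) hn0re
  refine ⟨fun k hk => eq_one_or_negOne_of_su2Quat (huns k hk), fun k₁ k₂ hk₁ hk₂ => eq_one_or_negOne_of_su2Quat ?_⟩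
  rw [su2Quat_mul]
  rcases htws k₁ hk₁ with h1 | h1 <;> rcases htws k₂ hk₂ with h2 | h2 <;> rw [h1, h2]
  · right; rw [hnn]
  · left; rw [mul_neg, hnn, neg_neg]
  · left; rw [neg_mul, hnn, neg_neg]
  · right; rw [neg_mul, mul_neg, neg_neg, hnn]

/-- Two DIFFERENT signs are at Frobenius distance at least `2` (in fact `2√2`). [folklore] -/
theorem two_le_fd_of_sign_ne {a a' : SU2} (ha : a = 1 ∨ a = negOne) (ha' : a' = 1 ∨ a' = negOne) (hne : a ≠ a') : 2 ≤ fd a a' := by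
  have h2 : ‖(2 : ℍ)‖ = 2 := by
    rw [show (2 : ℍ) = ((2 : ℝ) : ℍ) by norm_cast, Quaternion.norm_coe]; norm_num
  have key : ‖su2Quat a - su2Quat a'‖ = 2 := by
    rcases ha with rfl | rfl <;> rcases ha' with rfl | rfl
    · exact absurd rfl hne
    · rw [su2Quat_one, su2Quat_negOne, sub_neg_eq_add, one_add_one_eq_two, h2]
    · rw [su2Quat_one, su2Quat_negOne, ← norm_neg, neg_sub, sub_neg_eq_add, one_add_one_eq_two, h2]
    · exact absurd rfl hne
  linarith [norm_su2Quat_sub_le_fd a a']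

/-- A sign is central: `u a u⁻¹ = a`. [folklore] -/
theorem conj_eq_self_of_sign {a : SU2} (ha : a = 1 ∨ a = negOne) (u : SU2) : u * a * u⁻¹ = a := by
  rcases ha with rfl | rfl
  · rw [mul_one, mul_inv_cancel]
  · rw [← negOne_mul_comm u, mul_assoc, mul_inv_cancel, mul_one]

/-! ## §2 ★★ Quantitative separation of different twist-eater orbits -/

section Ring

variable {L : ℕ} [NeZero L]

/-- ★★ **Quantitative orbit separation.**  For `L ≥ 2`, a twist `z` with a twisted direction `k₀`, two comb-form twist-eater rings with wraps
`w, w'` (commuting, twist-eater relations w.r.t. `c`, `c'`) and ARBITRARY seam fields `g, g'`, and EVERY gauge field `h`: if an untwisted wrap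
sign or a twisted product sign differs, then the chordal ring distance between `h · (combFlat w; g)` and `(combFlat w'; g')` is at least
`1/(18L)`.  (So the gauge orbits of two zeros of `F_z` with different invariants are `1/(18L)`-separated; the tubes of the direct Laplace road,
of radius `1/poly(L)` below this, are disjoint.) [cite: Luscher1983, §2] [cite: GonzalezarroyoAltes1988, §2] -/
theorem ringDist_ge_of_invariants_ne (hL : 2 ≤ L) (z : Fin 3 → Bool) (k₀ : Fin 3) (hk₀ : z k₀ = true)
    {w w' : Fin 3 → SU2} {c c' : SU2}
    (hww : ∀ i j, w i * w j = w j * w i) (hcw : ∀ k, c * w k * c⁻¹ = centreElem (z k) * w k)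
    (hww' : ∀ i j, w' i * w' j = w' j * w' i) (hcw' : ∀ k, c' * w' k * c'⁻¹ = centreElem (z k) * w' k)
    (hne : (∃ k, z k = false ∧ w k ≠ w' k) ∨ (∃ k₁ k₂, z k₁ = true ∧ z k₂ = true ∧ w k₁ * w k₂ ≠ w' k₁ * w' k₂))
    (g g' h : Site 3 L → SU2) :
    1 / (18 * (L : ℝ)) ≤
      (∑ _i : Fin (2 * L - 1 + 1), (6 * (L : ℝ) ^ 3 - timeCoupling su2Rep (gaugeTransform h (combFlat w)) (combFlat (L := L) w'))) +
        ∑ x : Site 3 L, (2 - ((su2Rep ((h * g * h⁻¹) x * (g' x)⁻¹)).trace).re) := by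
  haveI : Fact (1 < L) := ⟨hL⟩
  have hL1 : (1 : ℝ) ≤ (L : ℝ) := by exact_mod_cast NeZero.one_le
  have hL0 : (0 : ℝ) < (L : ℝ) := by linarith
  set F : GaugeConfig 3 L SU2 := combFlat w with hF
  set F' : GaugeConfig 3 L SU2 := combFlat w' with hF'
  -- the common slice term `T` and the seam sum `S₂ ≥ 0`
  set T : ℝ := 6 * (L : ℝ) ^ 3 - timeCoupling su2Rep (gaugeTransform h F) F' with hT
  have hT_eq : T = ∑ e : Edge 3 L, ‖su2Quat (gaugeTransform h F e) - su2Quat (F' e)‖ ^ 2 := timeCoupling_deficit_eq _ _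
  have hT0 : 0 ≤ T := by rw [hT_eq]; positivity
  have hseam_nonneg : ∀ x : Site 3 L, 0 ≤ 2 - ((su2Rep ((h * g * h⁻¹) x * (g' x)⁻¹)).trace).re := fun x => by
    rw [ConstTube.re_trace_su2Rep_mul_inv_eq_norm]; nlinarith [norm_nonneg (su2Quat ((h * g * h⁻¹) x) - su2Quat (g' x))]
  have hS2 : 0 ≤ ∑ x : Site 3 L, (2 - ((su2Rep ((h * g * h⁻¹) x * (g' x)⁻¹)).trace).re) := Finset.sum_nonneg fun x _ => hseam_nonneg x
  have hsum : (∑ _i : Fin (2 * L - 1 + 1), T) = 2 * (L : ℝ) * T := by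
    rw [Finset.sum_const, Finset.card_univ, Fintype.card_fin, nsmul_eq_mul]
    have h2 : ((2 * L - 1 + 1 : ℕ) : ℝ) = 2 * (L : ℝ) := by
      rw [Nat.sub_add_cancel (by omega)]; push_cast; ring
    rw [h2]
  -- it suffices to bound `T` from below by `1/(36L²)`
  suffices hTlow : 1 / (36 * (L : ℝ) ^ 2) ≤ T by
    rw [hsum]
    have h1 : 1 / (18 * (L : ℝ)) = 2 * (L : ℝ) * (1 / (36 * (L : ℝ) ^ 2)) := by field_simp; ring
    rw [h1]
    nlinarith [mul_le_mul_of_nonneg_left hTlow (by positivity : (0 : ℝ) ≤ 2 * (L : ℝ))]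
  -- per-link closeness `δ = 2√T`
  set δ : ℝ := 2 * Real.sqrt T with hδ
  have hδ0 : 0 ≤ δ := by positivity
  have hGT : ∀ (s : Site 3 L → SU2) (X : GaugeConfig 3 L SU2) (x : Site 3 L) (k : Fin 3),
      gaugeTransform s X (x, k) = s x * X (x, k) * (s (x.shift k))⁻¹ := fun _ _ _ _ => rfl
  have hlinkδ : ∀ (x : Site 3 L) (k : Fin 3), fd (h x * F (x, k) * (h (x.shift k))⁻¹) (F' (x, k)) ≤ δ := by
    intro x k
    have h0 : ‖su2Quat (gaugeTransform h F (x, k)) - su2Quat (F' (x, k))‖ ^ 2 ≤ T := by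
      rw [hT_eq]
      exact Finset.single_le_sum (f := fun e : Edge 3 L => ‖su2Quat (gaugeTransform h F e) - su2Quat (F' e)‖ ^ 2)
        (fun _ _ => by positivity) (Finset.mem_univ (x, k))
    have h1 : ‖su2Quat (gaugeTransform h F (x, k)) - su2Quat (F' (x, k))‖ ≤ Real.sqrt T := (Real.le_sqrt (norm_nonneg _) hT0).2 h0
    rw [← hGT]
    linarith [fd_le_two_mul_norm_su2Quat_sub (gaugeTransform h F (x, k)) (F' (x, k))]
  -- along tree edges `h` is `δ`-constant
  have htree : ∀ e : Edge 3 L, treeEdge e = true → fd (h (e.1.shift e.2)) (h e.1) ≤ δ := by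
    rintro ⟨x, k⟩ he
    have hxk : x k ≠ -1 := apply_ne_neg_one_of_treeEdge he
    have h1 := hlinkδ x k
    rw [hF, hF', combFlat_apply, combFlat_apply] at h1
    simp only [if_neg hxk, mul_one] at h1
    have e : fd (h x * (h (x.shift k))⁻¹) 1 = fd (h x) (h (x.shift k)) := by
      rw [← fd_mul_right (h (x.shift k)) (h x * (h (x.shift k))⁻¹) 1, inv_mul_cancel_right, one_mul]
    rw [e] at h1
    rw [fd_comm]
    exact h1
  set u : SU2 := h 0 with hu
  have hconst : ∀ x : Site 3 L, fd (h x) u ≤ 3 * ((L : ℝ) - 1) * δ := fun x => fd_sub_base_le_of_treeEdge hδ0 htree x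
  -- every wrap edge: `u w_k u⁻¹ ≈ w'_k` within `3Lδ`
  have hwrap : ∀ k : Fin 3, fd (u * w k * u⁻¹) (w' k) ≤ 3 * (L : ℝ) * δ := by
    intro k
    set m : Site 3 L := mk3 (if k = 0 then (-1 : ZMod L) else 0) (if k = 1 then (-1 : ZMod L) else 0)
      (if k = 2 then (-1 : ZMod L) else 0) with hm
    have hshift : m.shift k = 0 := wrapEdge_shift k
    have hmk : m k = -1 := by rw [hm]; fin_cases k <;> simp [mk3]
    have h1 := hlinkδ m k
    rw [hshift, hF, hF', combFlat_apply, combFlat_apply] at h1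
    simp only [if_pos hmk] at h1
    rw [← hu] at h1
    have e : fd (u * w k * u⁻¹) (h m * w k * u⁻¹) = fd u (h m) := by rw [fd_mul_right, fd_mul_right]
    calc fd (u * w k * u⁻¹) (w' k) ≤ fd (u * w k * u⁻¹) (h m * w k * u⁻¹) + fd (h m * w k * u⁻¹) (w' k) := fd_triangle _ _ _
      _ ≤ 3 * ((L : ℝ) - 1) * δ + δ := by rw [e, fd_comm]; exact add_le_add (hconst m) h1
      _ ≤ 3 * (L : ℝ) * δ := by nlinarith
  -- the sign invariants of both twist-eaters
  obtain ⟨hun, htw⟩ := twistEater_sign_invariants z k₀ hk₀ hww hcw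
  obtain ⟨hun', htw'⟩ := twistEater_sign_invariants z k₀ hk₀ hww' hcw'
  -- a differing CENTRAL invariant is `2 ≤ 6Lδ`
  have hkey : (2 : ℝ) ≤ 6 * (L : ℝ) * δ := by
    rcases hne with ⟨k, hk, hwk⟩ | ⟨k₁, k₂, hk₁, hk₂, hwk⟩
    · have ha := hun k hk
      have ha' := hun' k hk
      have h2 := two_le_fd_of_sign_ne ha ha' hwk
      rw [← conj_eq_self_of_sign ha u] at h2
      linarith [hwrap k]
    · have ha := htw k₁ k₂ hk₁ hk₂
      have ha' := htw' k₁ k₂ hk₁ hk₂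
      have h2 := two_le_fd_of_sign_ne ha ha' hwk
      rw [← conj_eq_self_of_sign ha u] at h2
      have e : u * (w k₁ * w k₂) * u⁻¹ = (u * w k₁ * u⁻¹) * (u * w k₂ * u⁻¹) := by group
      rw [e] at h2
      have h3 : fd ((u * w k₁ * u⁻¹) * (u * w k₂ * u⁻¹)) (w' k₁ * w' k₂) ≤ 3 * (L : ℝ) * δ + 3 * (L : ℝ) * δ :=
        calc fd ((u * w k₁ * u⁻¹) * (u * w k₂ * u⁻¹)) (w' k₁ * w' k₂)
            ≤ fd ((u * w k₁ * u⁻¹) * (u * w k₂ * u⁻¹)) (w' k₁ * (u * w k₂ * u⁻¹)) + fd (w' k₁ * (u * w k₂ * u⁻¹)) (w' k₁ * w' k₂) :=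
              fd_triangle _ _ _
          _ = fd (u * w k₁ * u⁻¹) (w' k₁) + fd (u * w k₂ * u⁻¹) (w' k₂) := by rw [fd_mul_right, fd_mul_left]
          _ ≤ 3 * (L : ℝ) * δ + 3 * (L : ℝ) * δ := add_le_add (hwrap k₁) (hwrap k₂)
      linarith
  -- `2 ≤ 12 L √T` ⇒ `1/(36L²) ≤ T`
  have hsqrt : 1 / (6 * (L : ℝ)) ≤ Real.sqrt T := by
    rw [hδ] at hkey
    rw [div_le_iff₀ (by positivity)]
    nlinarith
  have h36 : 1 / (36 * (L : ℝ) ^ 2) = (1 / (6 * (L : ℝ))) ^ 2 := by field_simp; ring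
  rw [h36]
  calc (1 / (6 * (L : ℝ))) ^ 2 ≤ Real.sqrt T ^ 2 := pow_le_pow_left₀ (by positivity) hsqrt 2
    _ = T := Real.sq_sqrt hT0

end Ring

end Summit.QuantumFields.YangMills.Theorems.VirialFluxGap.RingDeficit

end
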